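import Summits.BirchSwinnertonDyer.Rank1Residual.GaloisImage.HauptmodulJ27QuarticValuation
import Summits.BirchSwinnertonDyer.Rank1Residual.GaloisImage.HauptmodulNineValuationFive
import HarnessLib

/-!
# The level-`9` Hauptmodul at `v₃(j) = 3`, `j/27 ≡ 5 (mod 9)` is VALUATION-FORCED: from
# `j(S − 27) = S(S − 24)³`, `v(S) = v(3)` and `θ³ = S` alone, `v((3θ/(S − 3))² − 1)⁹ = v(3)²`
# (cell `b2b-bsdres`, team n1011, seat p02 gen 5 — row T-b11-F4, file F4c-H10 'Hauptmodul route,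
# curve-free core at v₃(j) = 3, part 2'; pure valuation algebra in `ℚ̄`)

HONEST FRAMING (cell `b2b-bsdres`, run/shared/lean/b2b/bsd-rank1-residual/, verbatim in every
file): the goal of the cell is to DELETE the COMBINATION-SHAPED residual classes of the
Birch–Swinnerton-Dyer formula for ALL analytic-rank `≤ 1` elliptic curves over `ℚ` — "full BSD
formula for every rank `≤ 1` curve in class `C`" assembled STRICTLY from published theorems — so
that the rank-`≤ 1` remainder becomes exactly the CONSTRUCTION-SHAPED classes, which are TYPED
(missing-input `Prop`s), NOT attempted. This is not "finishing BSD". Team n1011 (N10 / N11):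
research route; no claim beyond the stated classes; labels UNCHANGED; nothing is booked. Theorems
only (no definition, no named fact).

## What this file proves

`v` the place of `ℚ̄` over `3`, `t = v(3)`.

* `two_le_padicValRat_of_nine_dvd_num`, `valuation_algebraMap_le_sq_of_nine_dvd_num` (§0) —
  `9 ∣ num(q)` ⟹ `2 ≤ v₃(q)`, `v(q) ≤ t²` for `q ∈ ℚ`.
* **`valuation_hauptmodul_nine_invariant_three_pow_nine`** (§1) — `j ∈ ℚ` with
  `9 ∣ num(j/27 − 5)` (i.e. `v₃(j) = 3` and `j/27 ≡ 5 (mod 9)`), `S, θ ∈ ℚ̄` with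
  `j(S − 27) = S(S − 24)³`, `v(S) = t`, `θ³ = S` ⟹ **`v((3θ/(S − 3))² − 1)⁹ = t²`**.
  Proof: `u = S/3 − 1`, `L = j/27`; `(X³ − 1)u⁶(20 − u)² = G₋G₊` for `X = (3θ/(S − 3))² = θ²/u²`
  (`θ⁶ = 9(u + 1)²`, `u³(20 − u) = (8L − 343) − (196 + L)u + 126u²`), and
  `v(G₋G₊) = t²v(u)²`, `v(u)³ = t` (`HauptmodulJ27QuarticValuation`), so `v(X³ − 1)³ = t²` and the
  cube-root lemma (`HauptmodulNineValuationFive.valuation_sub_one_pow_nine_of_cube_sq`) applies.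

For `E/ℚ` with `j/27 ≡ 5 (mod 9)` (so `v₃(j) = v₃(j − 1728) = 3`) and a cyclic `C ⊂ E[9]` over a
non-canonical `3`-torsion group, `θ = η(E, C) + 3` satisfies the hypotheses, so
`z = (3θ/(θ³ − 3))² − 1 ∈ ℚ(C)` is a `Stab(C)`-invariant with `v(z)⁹ = v(3)²`: the scalar-stabiliser
tower criterion gives the `3`-adic tower from surj(3) on this sub-family of the EXOTIC core
(84 census cells; EVIDENCE kit j134538, 84/84).  The complementary class `j/27 ≡ 8 (mod 9)`
(27 cells) is NOT covered.  Nothing booked.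

References: [Maier2006] Table 4 (N = 3, 9), §5.
-/

noncomputable section

set_option maxRecDepth 10000

open scoped Classical

namespace Summit.BirchSwinnertonDyer.Rank1Residual.GaloisImage

open Literature.NumberTheory.EllipticCurves Literature.NumberTheory.GaloisRepresentations
  Rat.HeightOneSpectrum

/-! ### §0 `9 ∣ num(q)` gives `v(q) ≤ v(3)²` -/

/-- For `q ∈ ℚ`, `q ≠ 0`, with `9 ∣ num(q)`: `2 ≤ v₃(q)` (the reduced denominator is prime to `3`).
[folklore] -/
theorem two_le_padicValRat_of_nine_dvd_num {q : ℚ} (hq : q ≠ 0) (h : (9 : ℤ) ∣ q.num) :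
    2 ≤ padicValRat 3 q := by
  haveI : Fact (Nat.Prime 3) := ⟨Nat.prime_three⟩
  have hnum0 : q.num ≠ 0 := Rat.num_ne_zero.mpr hq
  have h3n : (3 : ℤ) ∣ q.num := (Dvd.dvd.trans ⟨3, by norm_num⟩ h)
  have hd : ¬ 3 ∣ q.den := by
    intro hd
    have h3 : 3 ∣ Nat.gcd q.num.natAbs q.den := Nat.dvd_gcd (Int.natAbs_dvd_natAbs.mpr h3n) hd
    rw [q.reduced] at h3
    omega
  have hvn : 2 ≤ padicValInt 3 q.num :=
    ((padicValInt_dvd_iff 2 q.num).mp (by simpa using h)).resolve_left hnum0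
  have hvd : padicValNat 3 q.den = 0 := padicValNat.eq_zero_of_not_dvd hd
  have hdef : padicValRat 3 q = padicValInt 3 q.num - padicValNat 3 q.den := rfl
  rw [hdef, hvd]; push_cast; omega

/-- For `q ∈ ℚ` with `9 ∣ num(q)`: `v(q) ≤ v(3)²` in `ℚ̄`. [folklore] -/
theorem valuation_algebraMap_le_sq_of_nine_dvd_num {q : ℚ} (h : (9 : ℤ) ∣ q.num) :
    (placeOver 3).valuation (algebraMap ℚ (AlgebraicClosure ℚ) q) ≤
      (placeOver 3).valuation (3 : AlgebraicClosure ℚ) ^ 2 := by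
  by_cases hq : q = 0
  · rw [hq, map_zero]; exact zero_le
  have hv := two_le_padicValRat_of_nine_dvd_num hq h
  obtain ⟨m, hm, hm2⟩ : ∃ m : ℕ, padicValRat 3 q = m ∧ 2 ≤ m :=
    ⟨(padicValRat 3 q).toNat, by omega, by omega⟩
  calc (placeOver 3).valuation (algebraMap ℚ (AlgebraicClosure ℚ) q)
      = (placeOver 3).valuation (3 : AlgebraicClosure ℚ) ^ m :=
        valuation_ratCast_eq_pow_of_padicValRat hq hm
    _ ≤ (placeOver 3).valuation (3 : AlgebraicClosure ℚ) ^ 2 :=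
        pow_le_pow_right_of_le_one' valuation_three_lt_one.le hm2

/-! ### §1 Assembly at `v₃(j) = 3`, `j/27 ≡ 5 (mod 9)` -/

/-- **The level-`9` Hauptmodul at `j/27 ≡ 5 (mod 9)` is valuation-forced.**  Let `j ∈ ℚ` with
`9 ∣ num(j/27 − 5)`, and `S, θ ∈ ℚ̄` with `j(S − 27) = S(S − 24)³`, `v(S) = v(3)` and `θ³ = S`.
Then **`v((3θ/(S − 3))² − 1)⁹ = v(3)²`** — `3`-adic valuation exactly `2/9`.
[cite: Maier2006, Table 4 (N = 3, 9) and §5] -/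
theorem valuation_hauptmodul_nine_invariant_three_pow_nine {j : ℚ}
    (hj5 : (9 : ℤ) ∣ (j / 27 - 5).num) {S θ : AlgebraicClosure ℚ}
    (hS : algebraMap ℚ (AlgebraicClosure ℚ) j * (S - 27) = S * (S - 24) ^ 3)
    (hvS : (placeOver 3).valuation S = (placeOver 3).valuation (3 : AlgebraicClosure ℚ))
    (hθ : θ ^ 3 = S) :
    (placeOver 3).valuation ((3 * θ / (S - 3)) ^ 2 - 1) ^ 9 =
      (placeOver 3).valuation (3 : AlgebraicClosure ℚ) ^ 2 := by
  set v := (placeOver 3).valuation with hv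
  set t := v (3 : AlgebraicClosure ℚ) with ht
  have ht1 : t < 1 := valuation_three_lt_one
  have ht0 : t ≠ 0 := valuation_three_ne_zero
  have h3 : (3 : AlgebraicClosure ℚ) ≠ 0 := by norm_num
  -- `L = j/27 ≡ 5 (mod 9)`
  set L := algebraMap ℚ (AlgebraicClosure ℚ) (j / 27) with hLdef
  have hL5 : v (L - 5) ≤ t ^ 2 := by
    have e : L - 5 = algebraMap ℚ (AlgebraicClosure ℚ) (j / 27 - 5) := by
      rw [map_sub, map_ofNat]
    rw [e]
    exact valuation_algebraMap_le_sq_of_nine_dvd_num hj5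
  obtain ⟨h343, h196, h403, h253, h283, h139⟩ := valuation_facts_of_sub_five hL5
  have hjL : algebraMap ℚ (AlgebraicClosure ℚ) j = 27 * L := by
    rw [hLdef, map_div₀, map_ofNat, mul_div_cancel₀ _ (by norm_num : (27 : AlgebraicClosure ℚ) ≠ 0)]
  -- `u = S/3 − 1`
  obtain ⟨u, hSu⟩ : ∃ u : AlgebraicClosure ℚ, S = 3 * u + 3 := ⟨S / 3 - 1, by field_simp; ring⟩
  subst hSu
  have hq : u ^ 4 - 20 * u ^ 3 + 126 * u ^ 2 - (196 + L) * u + (8 * L - 343) = 0 := by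
    have h := rho_quartic_of_hauptmodul_three hS
    rw [hjL] at h
    have e : (3 * u + 3) / 3 - 2 = u - 1 := by field_simp; ring
    rw [e] at h
    linear_combination h
  have hu1 : v (u + 1) = 1 := by
    have e : u + 1 = (3 * u + 3) / 3 := by field_simp
    rw [e, map_div₀, hvS, div_self ht0]
  have hu := valuation_u_pow_three_eq h343 h196 hu1 hq
  set s := v u with hs
  have hs0 : s ≠ 0 := by
    intro h0; rw [h0, zero_pow three_ne_zero] at hu; exact ht0 hu.symm
  have hu0 : u ≠ 0 := (Valuation.ne_zero_iff _).mp hs0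
  have hG := valuation_factors_of_quartic_three h403 h253 h283 h139 hu
  -- `v(20 − u) = 1`
  have hle1 : ∀ n : ℕ, v (n : AlgebraicClosure ℚ) ≤ 1 := fun n ↦
    ((placeOver 3).valuation_le_one_iff _).mpr (natCast_mem (placeOver 3) n)
  have h20u : v (20 - u) = 1 := by
    have e : (20 : AlgebraicClosure ℚ) - u = 21 - (u + 1) := by ring
    have hlt : v (21 : AlgebraicClosure ℚ) < v (u + 1) := by
      rw [hu1, show (21 : AlgebraicClosure ℚ) = 7 * 3 by norm_num, map_mul]
      calc v 7 * t ≤ 1 * t := mul_le_mul' (by exact_mod_cast hle1 7) le_rfl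
        _ = t := one_mul t
        _ < 1 := ht1
    rw [e, valuation_sub_eq_of_lt' hlt, hu1]
  -- the key identity `(9(u + 1)² − u⁶)(20 − u)² = G₋ G₊`
  have hP : u ^ 3 * (20 - u) = (8 * L - 343) - (196 + L) * u + 126 * u ^ 2 := by
    linear_combination -hq
  have hprod : (9 * (u + 1) ^ 2 - u ^ 6) * (20 - u) ^ 2 =
      (403 - 8 * L + (253 + L) * u - 129 * u ^ 2) * (8 * L - 283 - (139 + L) * u + 123 * u ^ 2) := by
    linear_combination (-(u ^ 3 * (20 - u) + ((8 * L - 343) - (196 + L) * u + 126 * u ^ 2))) * hP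
  have h9u : v (9 * (u + 1) ^ 2 - u ^ 6) = t ^ 2 * s ^ 2 := by
    have h := congrArg v hprod
    rw [map_mul, map_mul, map_pow, h20u, one_pow, mul_one] at h
    rw [h]; exact hG
  -- `X = (3θ/(S − 3))² = θ²/u²`, `(X³ − 1)u⁶ = 9(u + 1)² − u⁶`
  have hX : (3 * θ / (3 * u + 3 - 3)) ^ 2 = θ ^ 2 / u ^ 2 := by
    rw [show (3 : AlgebraicClosure ℚ) * u + 3 - 3 = 3 * u by ring, mul_div_mul_left _ _ h3, div_pow]
  have hθ6 : θ ^ 6 = 9 * (u + 1) ^ 2 := by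
    rw [show θ ^ 6 = (θ ^ 3) ^ 2 by ring, hθ]; ring
  have hXu : ((θ ^ 2 / u ^ 2) ^ 3 - 1) * u ^ 6 = 9 * (u + 1) ^ 2 - u ^ 6 := by
    rw [← hθ6]; field_simp
  have hA : v ((θ ^ 2 / u ^ 2) ^ 3 - 1) * s ^ 4 = t ^ 2 := by
    have h := congrArg v hXu
    rw [map_mul, map_pow, h9u, ← hs, show s ^ 6 = s ^ 4 * s ^ 2 by rw [← pow_add], ← mul_assoc] at h
    exact mul_right_cancel₀ (pow_ne_zero 2 hs0) h
  have hcube : v ((θ ^ 2 / u ^ 2) ^ 3 - 1) ^ 3 = t ^ 2 := by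
    have h := congrArg (· ^ 3) hA
    rw [mul_pow, ← pow_mul, show 4 * 3 = 3 * 4 from rfl, pow_mul, hu] at h
    -- `h : A³ · t⁴ = (t²)³`
    have ht4 : t ^ 4 ≠ 0 := pow_ne_zero _ ht0
    have e : (t ^ 2) ^ 3 = t ^ 2 * t ^ 4 := by rw [← pow_mul, ← pow_add]
    rw [e] at h
    exact mul_right_cancel₀ ht4 h
  rw [hX]
  exact valuation_sub_one_pow_nine_of_cube_sq hcube

end Summit.BirchSwinnertonDyer.Rank1Residual.GaloisImage
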